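import Mathlib
import Summits.AtomisticToContinuum.HydrodynamicLimit.Theorems.InformationPercolationEngineKickFairRelEquilibriumMesoDefs
import HarnessLib

/-!
# `KickFairRelEquilibriumMeso`, line `Sketch` — glue T, part (c2): measurability and a.e. bounds of the
# windowed kick sums, from the plumbing predicate `PastMeasurable`

Helper file (`--supports stmt-AtomisticToContinuum-15177`) of the line lead for the registered glue stub
`stub_pinchTransfer`. Everything here is CONDITIONAL on the line's plumbing predicate `PastMeasurable`
(registered stub `stub_pastMeasurable`, taken as an explicit hypothesis `hM`), exactly as the glue consumes it:

* `measurable_countFn` — the normalised collision count `countFn` is measurable;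
* `measurable_kappa` — the centring `κ` (Mathlib `condExp` given the comap σ-algebra of the typed past) is
  Borel measurable (the comap σ-algebra is `≤` Borel because the past is measurable);
* `ae_abs_kappa_le` — `|κ| ≤ C` a.e. under the invariant law when `|g| ≤ C`
  (`ae_bdd_abs_condExp_of_ae_bdd_abs`);
* `slotSumGood` / `measurable_slotSumGood` / `slotSum_eq_slotSumGood_of_mem_good` — a fully good-set-guarded,
  measurable version of the windowed kick sum that agrees with `slotSum` on the good set (so `slotSum` is
  a.e.-strongly measurable under every law charging only the good set: `aestronglyMeasurable_slotSum`);
* `abs_slotSum_le_of_kappa_le` — on the good set, if `|κ_{i,n}(z)| ≤ C` for all `i, n` then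
  `|Z_{(t₁,t₂]}(z)| ≤ 2 C · countFn z` (`|h| ≤ 1`, `|g| ≤ C`).
-/

noncomputable section

open MeasureTheory Set Filter Topology
open scoped ENNReal Classical

namespace Summit.AtomisticToContinuum.HydrodynamicLimit.Theorems.KickFairRelEquilibriumMesoLine

open Literature.Analysis.FluidPDE Literature.MathematicalPhysics.KineticTheory

variable {σ : ℝ} {N : ℕ}

/-! ## Measurability -/

/-- The good-set-guarded count of collisions of `i` in `(0, τ]`. [folklore] -/
def gcnt (Φ : Flow σ N) (τ : ℝ) (z : Phase N) (i : Fin (N + 1)) : ℕ :=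
  if z ∈ Φ.good then cnt Φ τ z i else 0

/-- Under `PastMeasurable`, the guarded count is measurable. [folklore] -/
theorem measurable_gcnt (hM : PastMeasurable) (hσ : 0 < σ) (Φ : Flow σ N) (τ : ℝ) (i : Fin (N + 1)) :
    Measurable (fun z => gcnt Φ τ z i) :=
  (hM σ hσ N Φ 0 τ i 0).2.2

/-- Under `PastMeasurable`, the normalised collision count `countFn` is measurable. [folklore] -/
theorem measurable_countFn (hM : PastMeasurable) (hσ : 0 < σ) (Φ : Flow σ N) (τ : ℝ) :
    Measurable (countFn Φ τ) := by
  unfold countFn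
  refine Measurable.const_mul (Finset.measurable_sum _ fun i _ => ?_) _
  have h := measurable_gcnt hM hσ Φ τ i
  have : (fun z => (if z ∈ Φ.good then (cnt Φ τ z i : ℝ) else 0)) =
      fun z => ((gcnt Φ τ z i : ℕ) : ℝ) := by
    funext z; unfold gcnt; split_ifs <;> simp
  rw [this]
  exact (measurable_from_top (f := fun n : ℕ => (n : ℝ))).comp h

/-- Under `PastMeasurable`, the comap σ-algebra of the typed past is a sub-σ-algebra of the Borel one. [folklore] -/
theorem comap_past_le (hM : PastMeasurable) (hσ : 0 < σ) (Φ : Flow σ N) (r : ℝ) (i : Fin (N + 1)) (n : ℕ) :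
    MeasurableSpace.comap (fun z => past Φ r z i n) inferInstance ≤
      (inferInstance : MeasurableSpace (Phase N)) :=
  ((hM σ hσ N Φ r 0 i n).1).comap_le

/-- Under `PastMeasurable`, the centring `κ` is Borel measurable. [folklore] -/
theorem measurable_kappa (hM : PastMeasurable) (hσ : 0 < σ) (Φ : Flow σ N) (r : ℝ)
    (g : V3 × V3 × V3 → ℝ) (i : Fin (N + 1)) (n : ℕ) : Measurable (kappa Φ r g i n) := by
  unfold kappa
  exact (stronglyMeasurable_condExp.measurable).mono (comap_past_le hM hσ Φ r i n) le_rfl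

/-- **`|κ| ≤ C` almost everywhere** under the invariant law, when `|g| ≤ C`. [folklore] -/
theorem ae_abs_kappa_le (Φ : Flow σ N) (r : ℝ) {g : V3 × V3 × V3 → ℝ} {C : ℝ} (hg : ∀ p, |g p| ≤ C)
    (i : Fin (N + 1)) (n : ℕ) :
    ∀ᵐ z ∂(localGibbsLaw σ (fun _ => 1) (fun _ => 0) (fun _ => 1) N Φ), |kappa Φ r g i n z| ≤ C := by
  unfold kappa
  exact ae_bdd_abs_condExp_of_ae_bdd_abs (Eventually.of_forall fun z => hg _)

/-- Simultaneous version: a.e., `|κ_{i,n}| ≤ C` for all `i, n`. [folklore] -/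
theorem ae_forall_abs_kappa_le (Φ : Flow σ N) (r : ℝ) {g : V3 × V3 × V3 → ℝ} {C : ℝ} (hg : ∀ p, |g p| ≤ C) :
    ∀ᵐ z ∂(localGibbsLaw σ (fun _ => 1) (fun _ => 0) (fun _ => 1) N Φ),
      ∀ i : Fin (N + 1), ∀ n : ℕ, |kappa Φ r g i n z| ≤ C := by
  rw [ae_all_iff]; intro i
  rw [ae_all_iff]; intro n
  exact ae_abs_kappa_le Φ r hg i n

/-! ## A guarded, measurable version of the windowed kick sum -/

/-- The time component `t_{i,n}` read off the typed past (equals `Φ.nthCollisionTimeOf i n z` on the good set,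
`0` off it). [folklore] -/
def pastTime (Φ : Flow σ N) (r : ℝ) (z : Phase N) (i : Fin (N + 1)) (n : ℕ) : ℝ :=
  (past Φ r z i n).2.2.2

/-- On the good set the time component of the past is the `n`-th collision time. [folklore] -/
theorem pastTime_of_mem_good (Φ : Flow σ N) (r : ℝ) {z : Phase N} (hz : z ∈ Φ.good) (i : Fin (N + 1))
    (n : ℕ) : pastTime Φ r z i n = Φ.nthCollisionTimeOf i n z := by
  simp [pastTime, past, hz]

/-- The summand of the windowed kick sum, with the collision time read off the past. [folklore] -/
def slotTerm (Φ : Flow σ N) (r t₁ t₂ : ℝ) (g : V3 × V3 × V3 → ℝ) (h : Fin (N + 1) → ℕ → Past N → ℝ)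
    (i : Fin (N + 1)) (n : ℕ) (z : Phase N) : ℝ :=
  (if t₁ < pastTime Φ r z i n ∧ pastTime Φ r z i n ≤ t₂ then (1 : ℝ) else 0) *
    (h i n (past Φ r z i n) * (g (kick Φ i n z) - kappa Φ r g i n z))

/-- **The guarded windowed kick sum**: `ε/(N+1) Σ_i Σ_{n < gcnt} slotTerm`, where `gcnt` is the good-set-guarded
count (so it vanishes off the good set as far as the count is concerned). [folklore] -/
def slotSumGood (Φ : Flow σ N) (τ r t₁ t₂ : ℝ) (g : V3 × V3 × V3 → ℝ)
    (h : Fin (N + 1) → ℕ → Past N → ℝ) (z : Phase N) : ℝ :=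
  hsDiameter σ N / ((N : ℝ) + 1) * ∑ i : Fin (N + 1), ∑ n ∈ Finset.range (gcnt Φ τ z i),
    slotTerm Φ r t₁ t₂ g h i n z

/-- On the good set the guarded windowed kick sum is the windowed kick sum. [folklore] -/
theorem slotSum_eq_slotSumGood_of_mem_good (Φ : Flow σ N) (τ r t₁ t₂ : ℝ) (g : V3 × V3 × V3 → ℝ)
    (h : Fin (N + 1) → ℕ → Past N → ℝ) {z : Phase N} (hz : z ∈ Φ.good) :
    slotSum Φ τ r t₁ t₂ g h z = slotSumGood Φ τ r t₁ t₂ g h z := by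
  unfold slotSum slotSumGood slotTerm gcnt
  simp only [hz, if_true, pastTime_of_mem_good Φ r hz]

/-- Under `PastMeasurable`, each summand `slotTerm` is measurable (measurable weights, continuous `g`). [folklore] -/
theorem measurable_slotTerm (hM : PastMeasurable) (hσ : 0 < σ) (Φ : Flow σ N) (r t₁ t₂ : ℝ)
    {g : V3 × V3 × V3 → ℝ} (hg : Continuous g) {h : Fin (N + 1) → ℕ → Past N → ℝ}
    (hh : ∀ i n, Measurable (h i n)) (i : Fin (N + 1)) (n : ℕ) :
    Measurable (slotTerm Φ r t₁ t₂ g h i n) := by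
  have hP : Measurable (fun z => past Φ r z i n) := (hM σ hσ N Φ r 0 i n).1
  have hX : Measurable (kick Φ i n) := (hM σ hσ N Φ r 0 i n).2.1
  have hT : Measurable (fun z => pastTime Φ r z i n) := by
    unfold pastTime
    exact measurable_snd.comp (measurable_snd.comp (measurable_snd.comp hP))
  unfold slotTerm
  refine Measurable.mul ?_ (((hh i n).comp hP).mul ((hg.measurable.comp hX).sub
    (measurable_kappa hM hσ Φ r g i n)))
  refine Measurable.ite ?_ measurable_const measurable_const
  exact (measurableSet_lt measurable_const hT).inter (measurableSet_le hT measurable_const)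

/-- **A sum with a measurable random number of measurable summands is measurable** (limit of the truncated
sums, which are eventually constant pointwise). [folklore] -/
theorem measurable_sum_range_of_measurable {α : Type*} [MeasurableSpace α] {F : ℕ → α → ℝ}
    (hF : ∀ n, Measurable (F n)) {K : α → ℕ} (hK : Measurable K) :
    Measurable fun z => ∑ n ∈ Finset.range (K z), F n z := by
  -- truncated sums
  have htr : ∀ M : ℕ, Measurable fun z => ∑ n ∈ Finset.range M, (if n < K z then F n z else 0) := by
    intro M
    refine Finset.measurable_sum _ fun n _ => ?_
    refine Measurable.ite ?_ (hF n) measurable_const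
    exact measurableSet_lt measurable_const hK
  refine measurable_of_tendsto_metrizable htr ?_
  rw [tendsto_pi_nhds]
  intro z
  refine tendsto_atTop_of_eventually_const (i₀ := K z) fun M hM => ?_
  -- for `M ≥ K z` the truncated sum is the full sum
  rw [← Finset.sum_range_add_sum_Ico _ hM]
  have h1 : ∑ n ∈ Finset.range (K z), (if n < K z then F n z else 0) = ∑ n ∈ Finset.range (K z), F n z :=
    Finset.sum_congr rfl fun n hn => by rw [if_pos (Finset.mem_range.1 hn)]
  have h2 : ∑ n ∈ Finset.Ico (K z) M, (if n < K z then F n z else 0) = 0 :=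
    Finset.sum_eq_zero fun n hn => by rw [if_neg (not_lt.2 (Finset.mem_Ico.1 hn).1)]
  rw [h1, h2, add_zero]

/-- Under `PastMeasurable`, the guarded windowed kick sum is measurable. [folklore] -/
theorem measurable_slotSumGood (hM : PastMeasurable) (hσ : 0 < σ) (Φ : Flow σ N) (τ r t₁ t₂ : ℝ)
    {g : V3 × V3 × V3 → ℝ} (hg : Continuous g) {h : Fin (N + 1) → ℕ → Past N → ℝ}
    (hh : ∀ i n, Measurable (h i n)) : Measurable (slotSumGood Φ τ r t₁ t₂ g h) := by
  unfold slotSumGood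
  refine Measurable.const_mul (Finset.measurable_sum _ fun i _ => ?_) _
  exact measurable_sum_range_of_measurable (fun n => measurable_slotTerm hM hσ Φ r t₁ t₂ hg hh i n)
    (measurable_gcnt hM hσ Φ τ i)

/-- **The windowed kick sum is a.e.-strongly measurable under every law charging only the good set.** [folklore] -/
theorem aestronglyMeasurable_slotSum (hM : PastMeasurable) (hσ : 0 < σ) (Φ : Flow σ N) (τ r t₁ t₂ : ℝ)
    {g : V3 × V3 × V3 → ℝ} (hg : Continuous g) {h : Fin (N + 1) → ℕ → Past N → ℝ}
    (hh : ∀ i n, Measurable (h i n)) {μ : Measure (Phase N)} (hμ : μ Φ.goodᶜ = 0) :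
    AEStronglyMeasurable (slotSum Φ τ r t₁ t₂ g h) μ := by
  refine ⟨slotSumGood Φ τ r t₁ t₂ g h, (measurable_slotSumGood hM hσ Φ τ r t₁ t₂ hg hh).stronglyMeasurable,
    ?_⟩
  have : ∀ᵐ z ∂μ, z ∈ Φ.good := mem_ae_iff.2 hμ
  filter_upwards [this] with z hz
  exact slotSum_eq_slotSumGood_of_mem_good Φ τ r t₁ t₂ g h hz

/-! ## The pathwise bound `|Z| ≤ 2C · countFn` on the good set -/

/-- **On the good set, `|Z_{(t₁,t₂]}(z)| ≤ 2C · countFn z`** whenever `|g| ≤ C`, `|h| ≤ 1` and `|κ_{i,n}(z)| ≤ C`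
for all `i, n` (the last holds a.e. under the invariant law, `ae_forall_abs_kappa_le`). [folklore] -/
theorem abs_slotSum_le_of_kappa_le (Φ : Flow σ N) (hσ : 0 < σ) (τ r t₁ t₂ : ℝ) {g : V3 × V3 × V3 → ℝ}
    {C : ℝ} (hg : ∀ p, |g p| ≤ C) {h : Fin (N + 1) → ℕ → Past N → ℝ} (hh : ∀ i n p, |h i n p| ≤ 1)
    {z : Phase N} (hz : z ∈ Φ.good) (hκ : ∀ i : Fin (N + 1), ∀ n : ℕ, |kappa Φ r g i n z| ≤ C) :
    |slotSum Φ τ r t₁ t₂ g h z| ≤ 2 * C * countFn Φ τ z := by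
  have hC : 0 ≤ C := (abs_nonneg _).trans (hg 0)
  have hε : 0 ≤ hsDiameter σ N / ((N : ℝ) + 1) := div_nonneg (hsDiameter_pos hσ N).le (by positivity)
  unfold slotSum countFn
  rw [abs_mul, abs_of_nonneg hε, mul_comm (2 * C), mul_assoc]
  refine mul_le_mul_of_nonneg_left ?_ hε
  rw [Finset.sum_mul]
  refine (Finset.abs_sum_le_sum_abs _ _).trans (Finset.sum_le_sum fun i _ => ?_)
  simp only [hz, if_true]
  refine (Finset.abs_sum_le_sum_abs _ _).trans ?_
  calc ∑ n ∈ Finset.range (cnt Φ τ z i),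
        |(if t₁ < Φ.nthCollisionTimeOf i n z ∧ Φ.nthCollisionTimeOf i n z ≤ t₂ then (1 : ℝ) else 0) *
          (h i n (past Φ r z i n) * (g (kick Φ i n z) - kappa Φ r g i n z))|
      ≤ ∑ n ∈ Finset.range (cnt Φ τ z i), 2 * C := by
        refine Finset.sum_le_sum fun n _ => ?_
        rw [abs_mul, abs_mul]
        have h1 : |(if t₁ < Φ.nthCollisionTimeOf i n z ∧ Φ.nthCollisionTimeOf i n z ≤ t₂ then (1 : ℝ) else 0)| ≤ 1 := by
          split_ifs <;> simp
        have h2 : |h i n (past Φ r z i n)| ≤ 1 := hh i n _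
        have h3 : |g (kick Φ i n z) - kappa Φ r g i n z| ≤ 2 * C :=
          (abs_sub _ _).trans (by linarith [hg (kick Φ i n z), hκ i n])
        calc _ ≤ 1 * (1 * (2 * C)) := by
              refine mul_le_mul h1 (mul_le_mul h2 h3 (abs_nonneg _) zero_le_one) (by positivity) zero_le_one
          _ = 2 * C := by ring
    _ = (cnt Φ τ z i : ℝ) * (2 * C) := by rw [Finset.sum_const, Finset.card_range, nsmul_eq_mul]

/-- **Registered sub-goal `transferAE` of the glue (T-c2)**: under `PastMeasurable`, every windowed kick sum is
a.e.-strongly measurable under every law charging only the good set. [folklore] -/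
theorem transferAE : PastMeasurable → ∀ (σ : ℝ), 0 < σ → ∀ (N : ℕ) (Φ : Flow σ N) (τ r t₁ t₂ : ℝ)
    (g : V3 × V3 × V3 → ℝ), Continuous g → ∀ (h : Fin (N + 1) → ℕ → Past N → ℝ),
    (∀ i n, Measurable (h i n)) → ∀ (μ : Measure (Phase N)), μ Φ.goodᶜ = 0 →
    AEStronglyMeasurable (slotSum Φ τ r t₁ t₂ g h) μ :=
  fun hM _ hσ _ Φ τ r t₁ t₂ _ hg _ hh _ hμ => aestronglyMeasurable_slotSum hM hσ Φ τ r t₁ t₂ hg hh hμ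

end Summit.AtomisticToContinuum.HydrodynamicLimit.Theorems.KickFairRelEquilibriumMesoLine

end
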